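import Mathlib
import Literature.NumberTheory.EllipticCurves.FramedTateGaloisRep
import Literature.NumberTheory.EllipticCurves.HasseWeilGoodReductionProofs
import Literature.NumberTheory.Automorphic.BCDTModularity
import Literature.NumberTheory.Automorphic.ReciprocityGLnPotentialModularity
import Literature.NumberTheory.Automorphic.AlgebraicityTwist
import Literature.NumberTheory.Automorphic.TotallyRealModularityLargeImage
import Literature.NumberTheory.GaloisRepresentations.CartanNormalizerCriterionGaloisImage
import Literature.NumberTheory.GaloisRepresentations.DecomposedGeneric
import HarnessLib
import Literature.NumberTheory.EllipticCurves.Isogeny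

/-!
# CaraianiNewtonResidualImageModularity

Topic `Literature/NumberTheory/Automorphic`. Named literature fact(s) relocated by the gate from `Summits/Langlands/Langlands/Theorems/SkinnerWilesDefectOneEisensteinProModularSeedCousinAutomorphic.lean`
(accept-time relocation of `[cite]`d propositions written inline in a Summits proposal; human ruling 2026-08-15).
Sources: CaraianiNewton2023.

* `Literature.NumberTheory.Automorphic.CaraianiNewton2023_cor611_modular`

## Status of the discharge `CaraianiNewton2023_cor611_modular_holds` (triage 2026-08-16: XL)

The printed proof of Cor. 6.1.1 (p. 87 of the held arXiv text `paper:arxiv-2301.10509`) is one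
line, *"Combine Theorem 6.1 and Lemma 6.2.2"*, and both ingredients are out of inline reach:

* **Lemma 6.2.2** (pp. 90–91: `F/ℚ` quadratic, `p` odd, `ρ̄|_{G_{F(ζ_p)}}` absolutely irreducible
  ⟹ `ρ̄` decomposed generic) uses Goursat's lemma, Dickson's classification, Galois closures over
  `ℚ` and the Chebotarev density theorem; its finite-group steps are proved in
  `GaloisRepresentations/CartanNormalizerCriterionGaloisImage` (`CaraianiNewton.…`, including the
  assembled group-theoretic heart `CaraianiNewton.exists_disc_ne_zero_and_disc_apply_ne_zero`,
  2026-08-16), and Chebotarev's theorem in the existence form for Artin representations IS proved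
  in the tree (`Literature.NumberTheory.Automorphic.chebotarev_artinRep_holds`, file
  `Automorphic/ChebotarevArtinRepHolds`; an earlier version of this note said otherwise), and the
  Galois-theoretic assembly of Lemma 6.2.2 itself (`Γ_F ↪ Γ_ℚ`, outer conjugation by a lift of
  the non-trivial element of `Gal(F/ℚ)`, Frobenius bookkeeping at the split primes) has since
  LANDED as the theorem
  `Literature.NumberTheory.GaloisRepresentations.isDecomposedGeneric_of_isAbsolutelyIrreducible_restrictField_cyclotomic`
  (file `GaloisRepresentations/DecomposedGenericOfQuadratic`, 2026-08-16): of the two ingredients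
  only Theorem 6.1 remains out of reach.
* **Theorem 6.1** (p. 87; proof p. 90) combines the residual modularity Propositions 6.1.5/6.1.6
  ([AKT23, Props. 9.12–9.15]: modular curves `Y_ρ`, Hilbert irreducibility), Lemmas 6.1.3 / 6.1.7
  ([AKT23, Lemma 9.1]; Varma's local–global compatibility), the automorphy lifting Theorem 5.2
  (pp. 73–74: Taylor–Wiles–Kisin patching after [ACC⁺18, §6], `P`-ordinary Hida theory for
  completed cohomology §2, Galois determinants attached to torsion classes with the crystalline
  local–global compatibility Thm. 4.2.15, §§3–4, derived Ihara avoidance) and solvable descent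
  [ACC⁺18, Prop. 6.5.13]. None of these has a carrier in Mathlib or `Literature`, and D-0026
  forbids minting them as named facts from this seat; so the named fact stays a fact (as for the
  companion `CaraianiNewton2023_modularity`, file `CaraianiNewtonModularityProofs`).

**Review of the split (2026-08-16, `review-split`, D-0026 / D-0027 A7): kept as stated; an apex,
cited.**  This named fact is *not* a decomposition child of another fact: it was written inline,
with its `[cite]`, as the single unproved input of the route stub `stub_cousinAutomorphic`
(`Summits/Langlands/Langlands/Theorems/SkinnerWilesDefectOneEisensteinProModularSeedCousinAutomorphic`,
which takes it as an explicit hypothesis `CaraianiNewton2023_cor611_modular → …`) and relocated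
here by the gate, so there is no Literature parent to merge it back into, and it is the printed
corollary itself, not a slice of a printed proof.  Audit against the held text
(`paper:arxiv-2301.10509`), with the outcome that the statement is implied by, and no stronger
than, what the source prints and proves:
* *hypothesis* — "`SL₂(𝔽₃) ⊆ im ρ̄_{E,3}` for some framing" implies the printed (1)
  (`modPImageAbsIrreducibleOverCyclotomic_three_of_specialLinearGroup_le_range` below) and it
  excludes complex multiplication (docstring of the fact: over the compositum `FK`, of degree
  `≤ 2` over `F`, the image commutes with `𝒪/3𝒪 ↷ E[3] ≅ 𝒪/3𝒪` and is abelian, while `SL₂(𝔽₃)`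
  has no subgroup of index `2`), so of the two alternatives of "modular" (p. 2, footnote 1;
  §6 p. 87) only the cuspidal one can occur;
* *conclusion* — "modular" in §6 (p. 87) is `r_{π,ι} ≅ r_{E,p}^∨` for a cuspidal `π` of
  `GL₂(𝔸_F)` regular algebraic of weight `0` (`HasWeightZero`: `π_∞` has the infinitesimal
  character of `V_0^∨ = 1`, §1 p. 8), where `r_{E,p}` is the representation on the `p`-adic Tate
  module (its reduction has determinant `ε̄_p`, Prop. 6.1.5 p. 88); by Lemma 6.1.3 (2)–(3) (p. 88,
  [AKT23, Lemma 9.1]) the isomorphism holds for every `p` and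
  `WD(r_{E,p}^∨|_{G_{F_v}})^{F-ss} ≅ rec^T_{F_v}(π_v)` at every `v ∤ p`; at a place `w` of good
  reduction (take `p ∤ w`) the left side is unramified with geometric-Frobenius polynomial
  `X² - a_w X + q_w`, so `π_w` is unramified and its Hecke polynomial
  `P_w(X) = X² - T_{w,1} X + q_w T_{w,2}` — eq. (2.1.5), p. 18: *"the characteristic polynomial
  of a Frobenius element on `rec^T_{F_v}(π_v)`"* — specialises to `X² - a_w X + q_w`; in the
  normalisation of `AutomorphicRepData.HasSatakeParamAt` (`T_{w,1} ↦ q_w^{1/2} e₁(α)`,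
  `T_{w,2} ↦ e₂(α)`) this is literally `HasHeckePolynomialAt w (X² - a_w X + q_w)`,
  i.e. `P_w = (X - q_w^{1/2} α₁)(X - q_w^{1/2} α₂)`.  Equivalently, with the definition on p. 2
  (*"parallel weight `2` whose associated `L`-function is the same as the `L`-function of `E`"*),
  `L_w(π, s - 1/2) = L_w(E, s)` at the good places.
Nothing in the statement needed correcting, the result is published and proved in the source, and
an inline discharge is out of reach for the reasons listed above; the fact therefore stays a cited
named hypothesis of its users (verdict `xl-apex`), exactly like `CaraianiNewton2023_modularity`.

What **is** proved below is the part of the argument that concerns the *rendering*: the route's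
hypothesis "some framing `ρ̄₃` of `E[3]` has image containing `SL₂(𝔽₃)`" implies the printed
hypothesis (1) of Cor. 6.1.1, "`ρ̄_{E,3}|_{G_{F(ζ₃)}}` is absolutely irreducible", in the tree's
existing rendering `ModPImageAbsIrreducibleOverCyclotomic E 3` (`TotallyRealModularityLargeImage`,
there for Freitas–Le Hung–Siksek Thm. 2 (ii)) — for **every** framing and every model of `F(ζ₃)`
(`modPImageAbsIrreducibleOverCyclotomic_three_of_specialLinearGroup_le_range`): by the Weil
pairing `det ρ̄ = χ̄₃` (`det_eq_modPCyclotomicCharacter_of_isTorsionGaloisRep_holds`), so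
`ρ̄(G_{F(ζ₃)}) = ρ̄(G_F) ∩ SL₂(𝔽₃) = SL₂(𝔽₃)` (FLS Prop. 3.1 (i)), which contains both elementary
transvections and acts absolutely irreducibly (source, p. 88, for `p = 5`;
`CaraianiNewton.isAbsIrreducible_comp_subtype_ker_det`); framings are conjugate
(`WeierstrassCurve.IsTorsionGaloisRep.exists_conj`, proved here) and `SL₂ = ker det` is normal.
Supporting lemmas: `IsAbsIrreducible.of_range_le` (absolute irreducibility is monotone in the
image), `ker_det_le_range_of_forall_specialLinearGroup`, `ker_det_le_range_of_conj`.  Finally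
`CaraianiNewton2023_cor611_modular_of_cor611_nonCM` records the named fact as the printed
Cor. 6.1.1 (1) for non-CM curves (read through Lemma 6.1.3 on Borel–Jacquet data) plus the
classical small-image property of CM curves, both taken as explicit hypotheses (no carriers), and
`CaraianiNewton2023_cor611_modular.exists_hasSatakeParamAt` reads the conclusion as the trace
identity `q_w^{1/2}(α₁ + α₂) = a_w(E)`, `q_w α₁ α₂ = q_w` for users of the fact.

## Status of the discharge `CaraianiNewton2023_cor611_nonCM_printed_holds` (triage 2026-08-16: XL)

The second named fact of this file (relocated block below) is Cor. 6.1.1 AS PRINTED for non-CM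
curves, hypotheses (1) ∨ (2).  Its printed proof is the same one line, *"Combine Theorem 6.1 and
Lemma 6.2.2"* (p. 87), so everything said above applies verbatim: Theorem 6.1 is the automorphy
lifting Thm. 5.2 (§§2–5) with [AKT23] and solvable descent, which has no carrier in Mathlib or
`Literature`; Lemma 6.2.2, by contrast, IS a theorem of the tree
(`isDecomposedGeneric_of_isAbsolutelyIrreducible_restrictField_cyclotomic`, file
`GaloisRepresentations/DecomposedGenericOfQuadratic`: Chebotarev through
`chebotarev_artinRep_holds`, the group theory through
`CaraianiNewton.exists_disc_ne_zero_and_disc_apply_ne_zero`); the fact stays a cited named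
hypothesis of its users.  What is proved at the end of the file is the architecture of that one
line in the tree's vocabulary — `CaraianiNewton2023_cor611_nonCM_printed_of_thm61_of_lemma622`:
Thm. 6.1 (rendered with `NumberField.IsCMField`, "`ζ₅ ∉ F`" and the decomposed-generic condition
`IsDecomposedGeneric` of `GaloisRepresentations/DecomposedGeneric`) and Lemma 6.2.2, both as
HYPOTHESES, imply the fact, the glue being that an imaginary quadratic field is imaginary CM
(`isCMField_of_isTotallyComplex_of_finrank_eq_two`) without `ζ₅`
(`eq_one_of_pow_eq_one_of_finrank_lt`, `[ℚ(ζ₅) : ℚ] = 4 > 2`) — together with the sanity bridges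
to and from the narrow fact (`CaraianiNewton2023_cor611_nonCM_printed.hyp_of_specialLinearGroup_le_range`,
`CaraianiNewton2023_cor611_nonCM_printed.cor611_modular`) and the trace-identity reading of its
conclusion (`CaraianiNewton2023_cor611_nonCM_printed.exists_hasSatakeParamAt`).  Hypothesis (L)
of that reduction is discharged by the tree's Lemma 6.2.2 in the sibling file
`Automorphic/CaraianiNewtonResidualImageModularityProofs`
(`CaraianiNewton2023_cor611_nonCM_printed_of_thm61`, the fact from Theorem 6.1 ALONE, proposed
there by the discharge seat of this fact on 2026-08-16; kept out of this file only to spare its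
Summits importers the import of `DecomposedGenericOfQuadratic`).

**Review of the split (2026-08-16, `review-split` of `CaraianiNewton2023_cor611_nonCM_printed`,
D-0026 / D-0027 A7): kept as stated; an apex, cited.**  Audited against the held text
(`paper:arxiv-2301.10509`: Cor. 6.1.1 and Thm. 6.1 p. 87, Lemma 6.1.3 p. 88, Lemma 6.2.2
pp. 90–91, eq. (2.1.5) p. 18, the definition of modular p. 2 and §6 p. 87).
(i) *Not a decomposition child.*  The def is the printed Cor. 6.1.1 itself (both alternatives,
non-CM case), written inline with its `[cite]` as the single unproved input of the route stub
`stub_cousinAutomorphicWide`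
(`Summits/Langlands/Langlands/Theorems/SkinnerWilesDefectOneEisensteinProModularSeedCousinAutomorphicWide`,
which takes it UNFOLDED as its first hypothesis; `stub_cousinAutomorphicWide_fact` takes it by
name) and relocated here by the gate.  It is not a slice of the proof of the companion
`CaraianiNewton2023_cor611_modular` but a GENERALISATION of it (alternative (2) serves the `p = 3`
cousins of that line, whose `E[3]` is reducible), and the companion follows from it only modulo
the classical small mod-`3` image of CM curves
(`CaraianiNewton2023_cor611_nonCM_printed.cor611_modular`, hypothesis (B)); so there is no parent
obligation to merge it back into, and deleting it would orphan its Summits importers.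
(ii) *Faithful, and no stronger than the source.*  Hypotheses: `F` imaginary quadratic ✓;
`¬ E.HasCM` is geometric (`End_{F̄}(E) = ℤ`), at least as strong as "without CM" in Lemma 6.1.3 /
[AKT23, Lemma 9.1], and it removes the CM alternative of "modular" (§6 p. 87; p. 2) ✓; (1) ∨ (2)
rendered by `ModPImageAbsIrreducibleOverCyclotomic E p`, universally over framings of `E[p]` and
models of `F(ζ_p)` — conjugate (`WeierstrassCurve.IsTorsionGaloisRep.exists_conj`), resp.
isomorphic, choices, and both exist (`WeierstrassCurve.exists_isTorsionGaloisRep`, Mathlib's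
`CyclotomicField p F`), so the universal rendering is not vacuous — hence equivalent to the
printed condition on `r̄_{E,p}|_{G_{F(ζ_p)}}` ✓.  Conclusion: a cuspidal `π` of `GL₂(𝔸_F)` with
`HasWeightZero` (= regular algebraic of weight `0`: `π_∞` has the infinitesimal character of the
trivial representation; Lemma 6.1.3 (1)) ✓ and, at every finite place `w` of good reduction,
`HasHeckePolynomialAt w (X² − a_w X + q_w)`, i.e. `π_w` unramified with `t_{w,1} = a_w(E)`,
`t_{w,2} = 1` in the double-coset normalisation of `HasSatakeParamAt` (`t_{w,1} = q_w^{1/2} e₁(α)`,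
`t_{w,2} = e₂(α)`) — which is what Lemma 6.1.3 (2)–(3) (`r_{π,ι} ≅ r_{E,p}^∨` for every `p`;
`WD(r_{E,p}^∨|_{G_{F_w}})^{F-ss} ≅ rec^T_{F_w}(π_w)` at `w ∤ p`) gives at a good place `w` (take
`p` prime to `q_w`): the left side is unramified, so `π_w` is spherical, and its Hecke polynomial
`X² − T_{w,1} X + q_w T_{w,2}` (eq. (2.1.5), p. 18: *"the characteristic polynomial of a
Frobenius element on `rec^T_{F_v}(π_v)`"*) is the Frobenius polynomial `X² − a_w X + q_w` of
`r_{E,p}^∨` ✓ (sanity check over `ℚ`: for `π` generated by a weight-`2` newform `f` of trivial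
character, unitarily normalised, the spherical vector at `ℓ ∤ N` has `T_ℓ`-eigenvalue
`ℓ^{1/2}(α₁ + α₂) = a_ℓ(f)` and `T_{ℓ,ℓ}`-eigenvalue `α₁ α₂ = 1`).  Nothing is asserted at the
bad places, at infinity beyond the weight, or for CM curves.  The carriers are the tree's
Borel–Jacquet data, not free-standing records (`CuspidalAutomorphicRepData`: an irreducible
stable subquotient `W / W'`, `W' < W`, of the space of cusp forms on `GL₂(𝔸_F)`, Borel–Jacquet
§4.4–4.6; `HasSatakeParamAt`: a level-`K(𝔫)` Hecke eigenvector in `W ∖ W'`), so the conclusion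
asks for an actual cuspidal eigenform with the Hecke eigenvalues of `E`.
(iii) *Published and proved, but an apex.*  The printed proof is "Theorem 6.1 + Lemma 6.2.2";
Lemma 6.2.2 is a theorem of the tree (above); Theorem 6.1 (proof p. 90) is Thm. 5.2 (automorphy
lifting: `P`-ordinary Hida theory for completed cohomology §2, Galois determinants for torsion
classes and local–global compatibility §§3–4, Taylor–Wiles–Kisin patching §5) with [AKT23, §9]
(residual modularity via the modular curves `Y_ρ̄` and Hilbert irreducibility, Props. 6.1.5 /
6.1.6; Lemmas 6.1.3 / 6.1.4 / 6.1.7) and solvable descent [ACC⁺18, Prop. 6.5.13] — none of which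
has a carrier in Mathlib or `Literature`, and D-0026 forbids minting them as named facts from a
review seat.  Verdict `xl-apex`: the statement needed no correction; the def stays the cited
named hypothesis of its users, reduced in the tree to Theorem 6.1 alone.
-/

namespace Literature.NumberTheory.Automorphic

open Literature.NumberTheory.Automorphic Literature.NumberTheory.GaloisRepresentations
open _root_.NumberField IsDedekindDomain Polynomial
open scoped _root_.NumberField MatrixGroups Matrix
open Field

universe u w

/-- NAMED FACT — **Caraiani–Newton (2023), Corollary 6.1.1 (1): an elliptic curve over an imaginary
quadratic field whose mod-`3` Galois image contains `SL₂(𝔽₃)` is modular.**  Printed (p. 87):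
*"Corollary 6.1.1. Let `F` be an imaginary quadratic field. Let `E/F` be an elliptic curve
satisfying one of the following two conditions: (1) `r̄_{E,3}|_{G_{F(ζ₃)}}` is absolutely
irreducible. (2) … Then `E` is modular"*, where (p. 2) *"we say that an elliptic curve `E/F` is
modular if either `E` has complex multiplication or if there exists a cuspidal automorphic
representation `π` of `GL₂(𝔸_F)` of parallel weight `2` whose associated `L`-function is the same
as the `L`-function of `E`"* (§6, p. 87: *"a cuspidal … automorphic representation `π` of
`GL₂(𝔸_F)` which is regular algebraic of weight `0`, with `r_{π,ι} ≅ r_{E,p}^∨`"*).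
Rendering.  `F` imaginary quadratic: `NumberField F`, `IsTotallyComplex F`, `finrank ℚ F = 2`.
`E`: a Weierstrass equation over `F` with `[E.IsElliptic]`.  HYPOTHESIS, specialised to the case
the route needs: the image of the mod-`3` representation `ρ̄_{E,3} : Γ_F → Aut(E[3]) ≅ GL₂(𝔽₃)`
(a framed model `ρ₃` of `E(F̄)[3]`, `WeierstrassCurve.IsTorsionGaloisRep`) contains `SL₂(𝔽₃)`.
This implies hypothesis (1) — `det ρ̄_{E,3}` is the mod-`3` cyclotomic character (Weil pairing), so
`ρ̄_{E,3}(G_{F(ζ₃)}) = im ρ̄_{E,3} ∩ SL₂(𝔽₃) = SL₂(𝔽₃)`, which acts absolutely irreducibly on `𝔽₃²`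
— and excludes complex multiplication (for a CM curve `im ρ̄_{E,3}` has an abelian subgroup of
index `≤ 2`, whereas `SL₂(𝔽₃)`, non-abelian of order `24` without subgroups of index `2`, has no
such subgroup), so the source's conclusion is its second alternative.  CONCLUSION, on the Borel–Jacquet data of `AutomorphicRepsGL`, verbatim the shape of
the accepted `IsAutomorphicOfWeightZero` (`ReciprocityGLnPotentialModularity`) for a curve over the
field `F`: there are `hF` (the compactness Prop needed to type `π`; it holds,
`isCompact_glFiniteIntegralLevel_holds`) and a CUSPIDAL automorphic representation datum `π` of
`GL₂(𝔸_F)` of weight zero (`HasWeightZero`: `π_∞` cohomological for the trivial coefficients =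
parallel weight `2` = regular algebraic of weight `0`) such that at every finite place `w` at which
`E` has good reduction (`WeierstrassCurve.HasGoodReductionAt`, the chosen local minimal model
reduces to an elliptic curve `Ẽ_w / k_w`) `π_w` is unramified with Hecke polynomial
`X² − a_w(E) X + q_w` (`AutomorphicRepData.HasHeckePolynomialAt`, `frobPoly`,
`a_w(E) = q_w + 1 − #Ẽ_w(k_w) = E.frobeniusTraceAt w`): for the Satake parameter `{α₁, α₂}` of
`π_w` (unitary normalisation of `HasSatakeParamAt`), `(X − q_w^{1/2} α₁)(X − q_w^{1/2} α₂) =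
X² − a_w X + q_w`, i.e. `L_w(π, s − 1/2) = L_w(E, s) = (1 − a_w q_w^{-s} + q_w^{1−2s})⁻¹`
(Silverman C.§16) — the printed identity of `L`-functions read Euler factor by Euler factor at the
places of good reduction (in the §6 form `r_{π,ι} ≅ r_{E,p}^∨`, unramified local–global
compatibility reads exactly this identity at a place `w ∤ p` of good reduction where `π_w` is
unramified).  Nothing is asserted at the places of bad reduction or at infinity beyond the weight.  Unproved in the tree (the proof is the whole of the source:
§§2–5, Thm. 5.2, Thm. 6.1 with [AKT], Lemma 6.2.2); users take
`(h : CaraianiNewton2023_cor611_modular)`.  Companion of the accepted `CaraianiNewton2023_modularity`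
(Thm. 1.1: ALL curves when `X₀(15)(F)` is finite, cofinitely many places, CM escape clause).
-- TODO(general form): hypothesis (1)/(2) as printed (absolute irreducibility over `F(ζ₃)` /
-- `F(ζ₅)`, conclusion with the CM alternative); Thm. 7.1 (2) (image not the normaliser of a split
-- Cartan); Thm. 6.1 over imaginary CM fields `F ∌ ζ₅` with the decomposed-generic condition.
[cite: CaraianiNewton2023, Cor. 6.1.1 (1) p. 87, with the definition of modular on p. 2 and in §6 p. 87]
[file NumberTheory/Automorphic/CaraianiNewtonResidualImageModularity] -/
def CaraianiNewton2023_cor611_modular : Prop :=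
  ∀ (F : Type) [Field F] [NumberField F], NumberField.IsTotallyComplex F → Module.finrank ℚ F = 2 →
    ∀ (E : WeierstrassCurve F) [E.IsElliptic],
      (∃ ρ₃ : Literature.NumberTheory.GaloisRepresentations.FramedGaloisRep F (ZMod 3) 2,
          E.IsTorsionGaloisRep 3 ρ₃ ∧
            ∀ g : Matrix.SpecialLinearGroup (Fin 2) (ZMod 3), ∃ σ,
              ρ₃ σ = Matrix.SpecialLinearGroup.toGL g) →
      ∃ (hF : Literature.NumberTheory.Automorphic.isCompact_glFiniteIntegralLevel 2 F)
        (π : Literature.NumberTheory.Automorphic.CuspidalAutomorphicRepData 2 F hF),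
        π.1.HasWeightZero ∧
          ∀ w : IsDedekindDomain.HeightOneSpectrum (NumberField.RingOfIntegers F),
            E.HasGoodReductionAt w →
              π.1.HasHeckePolynomialAt w
                ((Literature.NumberTheory.Automorphic.frobPoly (E.frobeniusTraceAt w)
                    w.residueCard).map (Int.castRingHom ℂ))

/-! ### Bookkeeping: the half-twist of a Satake parameter and the Frobenius polynomial of `E` -/

/-- **Reading the conclusion of the fact as the trace identity.** Granted
`CaraianiNewton2023_cor611_modular`, for `F` imaginary quadratic and `E / F` elliptic whose
mod-`3` image contains `SL₂(𝔽₃)` there is a weight-zero cuspidal `π` of `GL₂(𝔸_F)` which, at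
every finite place `w` of good reduction, is unramified with a Satake parameter `α = {α₁, α₂}`
satisfying `q_w^{1/2}(α₁ + α₂) = a_w(E)` and `(q_w^{1/2} α₁)(q_w^{1/2} α₂) = q_w` (compare the
coefficients of the Hecke polynomial `X² - a_w X + q_w`,
`exists_hasSatakeParamAt_of_hasHeckePolynomialAt_frobPoly`): the Euler factor identity
`L_w(π, s - 1/2) = L_w(E, s)` of the source's definition of "modular" (p. 2).
[cite: CaraianiNewton2023, Cor. 6.1.1 (1) and p. 2 (definition of modular)] -/
theorem CaraianiNewton2023_cor611_modular.exists_hasSatakeParamAt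
    (h : CaraianiNewton2023_cor611_modular) (F : Type) [Field F] [NumberField F]
    (hF : NumberField.IsTotallyComplex F) (hF2 : Module.finrank ℚ F = 2) (E : WeierstrassCurve F)
    [E.IsElliptic]
    (hE : ∃ ρ₃ : Literature.NumberTheory.GaloisRepresentations.FramedGaloisRep F (ZMod 3) 2,
      E.IsTorsionGaloisRep 3 ρ₃ ∧
        ∀ g : Matrix.SpecialLinearGroup (Fin 2) (ZMod 3), ∃ σ,
          ρ₃ σ = Matrix.SpecialLinearGroup.toGL g) :
    ∃ (hc : isCompact_glFiniteIntegralLevel 2 F) (π : CuspidalAutomorphicRepData 2 F hc),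
      π.1.HasWeightZero ∧
        ∀ w : HeightOneSpectrum (𝓞 F), E.HasGoodReductionAt w →
          ∃ α : Multiset ℂ, π.1.HasSatakeParamAt w α ∧
            ((Real.sqrt w.residueCard : ℝ) : ℂ) * α.sum = (E.frobeniusTraceAt w : ℂ) ∧
            ((Real.sqrt w.residueCard : ℝ) : ℂ) ^ 2 * α.prod = (w.residueCard : ℂ) := by
  obtain ⟨hc, π, h0, hH⟩ := h F hF hF2 E hE
  exact ⟨hc, π, h0, fun w hw ↦ exists_hasSatakeParamAt_of_hasHeckePolynomialAt_frobPoly (hH w hw)⟩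

/-! ### Absolute irreducibility is monotone in the image -/

/-- **Absolute irreducibility only depends on the image subgroup, monotonically**: if
`τ : Γ' →* GL_n(k)` is absolutely irreducible and `τ(Γ') ⊆ σ(Γ)` for `σ : Γ →* GL_n(k)`, then
`σ` is absolutely irreducible (after any extension of scalars `f : k →+* k'`, a `σ(Γ)`-stable
subspace of `k'ⁿ` is `τ(Γ')`-stable). (Curtis–Reiner, *Methods* I, §3B.) [folklore] -/
theorem _root_.Literature.NumberTheory.GaloisRepresentations.IsAbsIrreducible.of_range_le
    {Γ : Type*} [Group Γ] {Γ' : Type*} [Group Γ'] {k : Type w} [Field k] {n : ℕ}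
    {τ : Γ' →* GL (Fin n) k} {σ : Γ →* GL (Fin n) k} (hτ : IsAbsIrreducible τ)
    (h : τ.range ≤ σ.range) : IsAbsIrreducible σ := by
  intro k' _ f
  have hT := hτ k' f
  set T := glRepresentation ((Matrix.GeneralLinearGroup.map f).comp τ) with hTdef
  set R := glRepresentation ((Matrix.GeneralLinearGroup.map f).comp σ) with hRdef
  -- a `σ(Γ)`-stable submodule is `τ(Γ')`-stable
  have stable : ∀ (W : Subrepresentation R) (g' : Γ') ⦃v : Fin n → k'⦄,
      v ∈ W.toSubmodule → T g' v ∈ W.toSubmodule := by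
    intro W g' v hv
    obtain ⟨g, hg⟩ := h ⟨g', rfl⟩
    have e : T g' v = R g v := by
      simp only [hTdef, hRdef, MonoidHom.comp_apply, hg]
    rw [e]
    exact W.apply_mem_toSubmodule g hv
  haveI := hT
  have hbotT : (⊥ : Subrepresentation T).toSubmodule = ⊥ := rfl
  have htopT : (⊤ : Subrepresentation T).toSubmodule = ⊤ := rfl
  have hbotR : (⊥ : Subrepresentation R).toSubmodule = ⊥ := rfl
  have htopR : (⊤ : Subrepresentation R).toSubmodule = ⊤ := rfl
  refine { toNontrivial := ⟨⟨⊥, ⊤, fun hbt ↦ ?_⟩⟩, eq_bot_or_eq_top := fun W ↦ ?_ }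
  · apply (bot_ne_top : (⊥ : Subrepresentation T) ≠ ⊤)
    apply Subrepresentation.toSubmodule_injective
    rw [hbotT, htopT, ← hbotR, ← htopR, hbt]
  · -- `W` with the same underlying submodule, as a subrepresentation for `τ`
    let W' : Subrepresentation T := ⟨W.toSubmodule, stable W⟩
    have hW' : W'.toSubmodule = W.toSubmodule := rfl
    rcases eq_bot_or_eq_top W' with h0 | h1
    · refine Or.inl (Subrepresentation.toSubmodule_injective ?_)
      rw [hbotR, ← hbotT, ← h0, hW']
    · refine Or.inr (Subrepresentation.toSubmodule_injective ?_)
      rw [htopR, ← htopT, ← h1, hW']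

/-! ### `SL₂(𝔽_p) ⊆ im ρ̄`, and conjugate framings of `E[n]` -/

/-- The hypothesis "`ρ̄(Γ) ∋ g` for every `g ∈ SL₂(𝔽_p)`" (the shape used by
`CaraianiNewton2023_cor611_modular`) says that `ker det = SL₂(𝔽_p) ≤ ρ̄(Γ)`. [folklore] -/
theorem ker_det_le_range_of_forall_specialLinearGroup {Γ : Type*} [Group Γ] {p : ℕ}
    (ρ : Γ →* GL (Fin 2) (ZMod p))
    (hSL : ∀ g : Matrix.SpecialLinearGroup (Fin 2) (ZMod p), ∃ σ,
      ρ σ = Matrix.SpecialLinearGroup.toGL g) :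
    (Matrix.GeneralLinearGroup.det : GL (Fin 2) (ZMod p) →* (ZMod p)ˣ).ker ≤ ρ.range := by
  intro x hx
  rw [MonoidHom.mem_ker] at hx
  obtain ⟨σ, hσ⟩ := hSL ⟨(x : Matrix (Fin 2) (Fin 2) (ZMod p)), by
    rw [← Matrix.GeneralLinearGroup.val_det_apply, hx, Units.val_one]⟩
  exact ⟨σ, by rw [hσ]; exact Units.ext rfl⟩

/-- `SL_n ≤ im ρ̄` is invariant under conjugation of `ρ̄` (`SL_n = ker det` is normal in `GL_n`).
[folklore] -/
theorem ker_det_le_range_of_conj {Γ : Type*} [Group Γ] {R : Type*} [CommRing R] {n : ℕ}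
    {ρ ρ' : Γ →* GL (Fin n) R} (P : GL (Fin n) R) (hconj : ∀ σ, ρ' σ = P * ρ σ * P⁻¹)
    (h : (Matrix.GeneralLinearGroup.det : GL (Fin n) R →* Rˣ).ker ≤ ρ.range) :
    (Matrix.GeneralLinearGroup.det : GL (Fin n) R →* Rˣ).ker ≤ ρ'.range := by
  intro x hx
  have hx' : P⁻¹ * x * P ∈ (Matrix.GeneralLinearGroup.det : GL (Fin n) R →* Rˣ).ker := by
    rw [MonoidHom.mem_ker] at hx ⊢
    rw [map_mul, map_mul, hx, mul_one, ← map_mul, inv_mul_cancel, map_one]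
  obtain ⟨σ, hσ⟩ := h hx'
  exact ⟨σ, by rw [hconj, hσ]; group⟩

/-- **Any two framings of `E[n]` are conjugate.** If `ρ̄` and `ρ̄'` are both matrix forms of the
Galois action on the geometric `n`-torsion of `W` (`WeierstrassCurve.IsTorsionGaloisRep`, for
additive framings `e, e' : E[n](F̄) ≃ (ℤ/n)²`), then `ρ̄' = P ρ̄ P⁻¹` for the matrix
`P ∈ GL₂(ℤ/n)` of the `ℤ/n`-linear automorphism `e' ∘ e⁻¹` of `(ℤ/n)²` (Silverman, *AEC* III.7:
`ρ̄_{E,n} : G → Aut(E[n]) ≅ GL₂(ℤ/nℤ)`, "the latter isomorphism involving the choice of a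
basis"). [folklore] -/
theorem _root_.WeierstrassCurve.IsTorsionGaloisRep.exists_conj {F : Type u} [Field F]
    {W : WeierstrassCurve F} {n : ℕ}
    {ρ ρ' : Literature.NumberTheory.GaloisRepresentations.FramedGaloisRep F (ZMod n) 2}
    (h : W.IsTorsionGaloisRep n ρ) (h' : W.IsTorsionGaloisRep n ρ') :
    ∃ P : GL (Fin 2) (ZMod n), ∀ σ, ρ' σ = P * ρ σ * P⁻¹ := by
  obtain ⟨e, he⟩ := h
  obtain ⟨e', he'⟩ := h'
  -- `θ = e' ∘ e⁻¹` and its inverse, as `ℤ/n`-linear endomorphisms of `(ℤ/n)²`, and their matrices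
  let θ : (Fin 2 → ZMod n) →ₗ[ZMod n] (Fin 2 → ZMod n) :=
    (e.symm.trans e').toAddMonoidHom.toZModLinearMap n
  let θ' : (Fin 2 → ZMod n) →ₗ[ZMod n] (Fin 2 → ZMod n) :=
    (e'.symm.trans e).toAddMonoidHom.toZModLinearMap n
  have hθθ' : θ.comp θ' = LinearMap.id := LinearMap.ext fun v ↦ by simp [θ, θ']
  have hθ'θ : θ'.comp θ = LinearMap.id := LinearMap.ext fun v ↦ by simp [θ, θ']
  set A : Matrix (Fin 2) (Fin 2) (ZMod n) := LinearMap.toMatrix' θ with hA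
  set B : Matrix (Fin 2) (Fin 2) (ZMod n) := LinearMap.toMatrix' θ' with hB
  have hAB : A * B = 1 := by rw [hA, hB, ← LinearMap.toMatrix'_comp, hθθ', LinearMap.toMatrix'_id]
  have hBA : B * A = 1 := by rw [hA, hB, ← LinearMap.toMatrix'_comp, hθ'θ, LinearMap.toMatrix'_id]
  refine ⟨⟨A, B, hAB, hBA⟩, fun σ ↦ Units.ext ?_⟩
  simp only [Units.val_mul, Units.inv_mk]
  refine Matrix.toLin'.injective (LinearMap.ext fun w ↦ ?_)
  simp only [Matrix.toLin'_apply]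
  obtain ⟨Q, rfl⟩ := e'.surjective w
  have h1 : B *ᵥ e' Q = e Q := by
    rw [hB, LinearMap.toMatrix'_mulVec]; simp [θ']
  have h2 : ((ρ σ : GL (Fin 2) (ZMod n)) : Matrix (Fin 2) (Fin 2) (ZMod n)) *ᵥ e Q = e (σ • Q) :=
    (he σ Q).symm
  have h3 : A *ᵥ e (σ • Q) = e' (σ • Q) := by
    rw [hA, LinearMap.toMatrix'_mulVec]; simp [θ]
  rw [← Matrix.mulVec_mulVec, ← Matrix.mulVec_mulVec, h1, h2, h3]
  exact (he' σ Q).symm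

/-! ### The route's hypothesis implies the printed hypothesis (1) of Cor. 6.1.1 -/

/-- **`SL₂(𝔽₃) ⊆ im ρ̄_{E,3}` implies that `ρ̄_{E,3}|_{G_{K(ζ₃)}}` is absolutely irreducible** (one
framing).  For an elliptic curve `E / K` (`char K = 0`), a framing `ρ̄` of `E[3]` whose image
contains `SL₂(𝔽₃) = ker det`, and any model `L` of `K(ζ₃)`: `det ρ̄ = χ̄₃` (Weil pairing,
`det_eq_modPCyclotomicCharacter_of_isTorsionGaloisRep_holds`), so
`ρ̄(G_{K(ζ₃)}) = ρ̄(G_K) ∩ SL₂(𝔽₃) = SL₂(𝔽₃)` (Freitas–Le Hung–Siksek Prop. 3.1 (i),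
`range_restrictField_cyclotomic_eq_of_isTorsionGaloisRep`), which contains the two elementary
transvections and therefore acts absolutely irreducibly on `𝔽₃²`
(`CaraianiNewton.isAbsIrreducible_comp_subtype_ker_det`; the source makes this remark on p. 88
for `p = 5`: *"if the image of `ρ̄_{E,5}` contains `SL₂(𝔽₅)`, we also have that
`ρ̄_{E,5}|_{G_{F(ζ₅)}}` is absolutely irreducible"*).  This is how the hypothesis of
`CaraianiNewton2023_cor611_modular` meets hypothesis (1) of Caraiani–Newton, Cor. 6.1.1.
[cite: CaraianiNewton2023, Cor. 6.1.1 (1) p. 87 and §6.1 p. 88] -/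
theorem isAbsolutelyIrreducible_restrictField_three_of_ker_det_le_range
    {K : Type u} [Field K] [CharZero K] (E : WeierstrassCurve K) [E.IsElliptic]
    {ρ : ModPGaloisRep K (ZMod 3) 2} (hρ : E.IsTorsionGaloisRep 3 ρ)
    (hSL : (Matrix.GeneralLinearGroup.det : GL (Fin 2) (ZMod 3) →* (ZMod 3)ˣ).ker ≤
      (ρ : absoluteGaloisGroup K →* GL (Fin 2) (ZMod 3)).range)
    (L : Type u) [Field L] [Algebra K L] [IsCyclotomicExtension {3} K L] :
    FramedRep.IsAbsolutelyIrreducible (FramedGaloisRep.restrictField L ρ) := by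
  rw [FramedRep.isAbsolutelyIrreducible_iff_coe]
  refine (CaraianiNewton.isAbsIrreducible_comp_subtype_ker_det
    (ρ : absoluteGaloisGroup K →* GL (Fin 2) (ZMod 3)) hSL).of_range_le ?_
  have hrange := range_restrictField_cyclotomic_eq_of_isTorsionGaloisRep E 3
    (E.det_eq_modPCyclotomicCharacter_of_isTorsionGaloisRep_holds 3) hρ L
  rw [MonoidHom.range_comp, Subgroup.range_subtype]
  change _ ≤ (FramedGaloisRep.restrictField L ρ).toMonoidHom.range
  rw [hrange]
  rintro _ ⟨γ, hγ, rfl⟩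
  exact Subgroup.mem_inf.2 ⟨⟨γ, rfl⟩, hγ⟩

/-- **The hypothesis of `CaraianiNewton2023_cor611_modular` implies hypothesis (1) of
Caraiani–Newton, Cor. 6.1.1, as rendered in the tree** (`ModPImageAbsIrreducibleOverCyclotomic E 3`
of `TotallyRealModularityLargeImage`: for EVERY framing `ρ̄` of `E[3]` and every model `L` of
`K(ζ₃)`, `ρ̄|_{Γ_L}` is absolutely irreducible).  If some framing `ρ̄₃` of `E[3]` has image
containing `SL₂(𝔽₃)` then so does every framing (all framings are conjugate,
`WeierstrassCurve.IsTorsionGaloisRep.exists_conj`, and `SL₂ = ker det` is normal,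
`ker_det_le_range_of_conj`), and `isAbsolutelyIrreducible_restrictField_three_of_ker_det_le_range`
applies.  Stated for any field `K` of characteristic `0`; the named fact uses it for `K = F`
imaginary quadratic. [cite: CaraianiNewton2023, Cor. 6.1.1 (1) p. 87] -/
theorem modPImageAbsIrreducibleOverCyclotomic_three_of_specialLinearGroup_le_range
    {K : Type u} [Field K] [CharZero K] (E : WeierstrassCurve K) [E.IsElliptic]
    (h : ∃ ρ₃ : Literature.NumberTheory.GaloisRepresentations.FramedGaloisRep K (ZMod 3) 2,
      E.IsTorsionGaloisRep 3 ρ₃ ∧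
        ∀ g : Matrix.SpecialLinearGroup (Fin 2) (ZMod 3), ∃ σ,
          ρ₃ σ = Matrix.SpecialLinearGroup.toGL g) :
    ModPImageAbsIrreducibleOverCyclotomic E 3 := by
  intro ρ hρ L _ _ _
  obtain ⟨ρ₃, h₃, hSL⟩ := h
  obtain ⟨P, hP⟩ := h₃.exists_conj hρ
  exact isAbsolutelyIrreducible_restrictField_three_of_ker_det_le_range E hρ
    (ker_det_le_range_of_conj (ρ := (ρ₃ : absoluteGaloisGroup K →* GL (Fin 2) (ZMod 3)))
      (ρ' := (ρ : absoluteGaloisGroup K →* GL (Fin 2) (ZMod 3))) P hP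
      (ker_det_le_range_of_forall_specialLinearGroup _ hSL)) L

/-! ### What the named fact is, modulo the printed theorem (reduction, not a discharge) -/

/-- **`CaraianiNewton2023_cor611_modular` from the printed Cor. 6.1.1 (1) for non-CM curves and
the small image of CM curves.**  Assume
(A) [Caraiani–Newton Cor. 6.1.1 (1), p. 87, for curves without complex multiplication, with
"modular" read through Lemma 6.1.3 (p. 88: `π` has weight `0`, `r_{π,ι} ≅ r_{E,p}^∨` for every
`p`, and `WD(r_{E,p}^∨|_{G_{F_v}})^{F-ss} ≅ rec^T(π_v)` at every `v ∤ p`) on the Borel–Jacquet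
data of `AutomorphicRepsGL`, exactly as in the conclusion of the named fact]: for `F` imaginary
quadratic and `E / F` elliptic without (geometric) CM (`¬ E.HasCM`) such that
`ρ̄_{E,3}|_{G_{F(ζ₃)}}` is absolutely irreducible (`ModPImageAbsIrreducibleOverCyclotomic E 3`),
there is a weight-zero cuspidal `π` of `GL₂(𝔸_F)` with Hecke polynomial `X² - a_w X + q_w` at
every finite place `w` of good reduction; and
(B) [the image of `ρ̄_{E,3}` of a CM curve does not contain `SL₂(𝔽₃)`: the endomorphisms are
defined over the compositum `F k` of degree `≤ 2`, and `ρ̄_{E,3}(G_{Fk})` commutes with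
`𝒪/3𝒪 ↷ E[3] ≅ 𝒪/3𝒪`, hence is abelian of order `≤ 8`, while `|SL₂(𝔽₃)| = 24`; Silverman,
*Advanced Topics* II.2.2 and *AEC* III.7]: for `E / F` elliptic with CM no framing of `E[3]` has
image containing `SL₂(𝔽₃)`.
Then `CaraianiNewton2023_cor611_modular` holds: the route's hypothesis gives (1)
(`modPImageAbsIrreducibleOverCyclotomic_three_of_specialLinearGroup_le_range`, proved above) and
excludes CM by (B), so (A) applies.  (A) and (B) are HYPOTHESES here, not named facts (D-0026):
(A) is the whole of the source (module docstring, "Status"), (B) needs the theory of complex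
multiplication; neither has a proof path in the tree today.  This theorem only records that the
named fact is no stronger than the printed Cor. 6.1.1 (1) so read.
[cite: CaraianiNewton2023, Cor. 6.1.1 (1) p. 87, Lemma 6.1.3 p. 88, footnote 1 p. 2] -/
theorem CaraianiNewton2023_cor611_modular_of_cor611_nonCM
    (hA : ∀ (F : Type) [Field F] [NumberField F], NumberField.IsTotallyComplex F →
      Module.finrank ℚ F = 2 → ∀ (E : WeierstrassCurve F) [E.IsElliptic], ¬ E.HasCM →
        ModPImageAbsIrreducibleOverCyclotomic E 3 →
          ∃ (hF : isCompact_glFiniteIntegralLevel 2 F) (π : CuspidalAutomorphicRepData 2 F hF),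
            π.1.HasWeightZero ∧
              ∀ w : HeightOneSpectrum (𝓞 F), E.HasGoodReductionAt w →
                π.1.HasHeckePolynomialAt w
                  ((frobPoly (E.frobeniusTraceAt w) w.residueCard).map (Int.castRingHom ℂ)))
    (hB : ∀ (F : Type) [Field F] [NumberField F] (E : WeierstrassCurve F) [E.IsElliptic],
      E.HasCM → ¬ ∃ ρ₃ : Literature.NumberTheory.GaloisRepresentations.FramedGaloisRep F (ZMod 3) 2,
        E.IsTorsionGaloisRep 3 ρ₃ ∧
          ∀ g : Matrix.SpecialLinearGroup (Fin 2) (ZMod 3), ∃ σ,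
            ρ₃ σ = Matrix.SpecialLinearGroup.toGL g) :
    CaraianiNewton2023_cor611_modular := by
  intro F _ _ hF hF2 E _ hE
  exact hA F hF hF2 E (fun hCM ↦ hB F E hCM hE)
    (modPImageAbsIrreducibleOverCyclotomic_three_of_specialLinearGroup_le_range E hE)

end Literature.NumberTheory.Automorphic

/-! ## Relocated from `Summits/Langlands/Langlands/Theorems/SkinnerWilesDefectOneEisensteinProModularSeedCousinAutomorphicWide.lean` (gate, accept-time relocation of cited facts) — CaraianiNewton2023 -/

namespace Literature.NumberTheory.Automorphic

open Literature.NumberTheory.Automorphic Literature.NumberTheory.GaloisRepresentations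
open NumberField IsDedekindDomain Polynomial
open scoped NumberField

/-- NAMED FACT — **Caraiani–Newton (2023), Corollary 6.1.1 AS PRINTED, for elliptic curves without
complex multiplication: an elliptic curve over an imaginary quadratic field with
`ρ̄_{E,3}|_{G_{F(ζ₃)}}` or `ρ̄_{E,5}|_{G_{F(ζ₅)}}` absolutely irreducible is modular.**  Printed
(p. 87): *"Corollary 6.1.1. Let `F` be an imaginary quadratic field. Let `E/F` be an elliptic curve
satisfying one of the following two conditions: (1) `r̄_{E,3}|_{G_{F(ζ₃)}}` is absolutely
irreducible. (2) `r̄_{E,5}|_{G_{F(ζ₅)}}` is absolutely irreducible. Then `E` is modular. Proof.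
Combine Theorem 6.1 and Lemma 6.2.2."*, where (§6, p. 87) *"By '`E` is modular', we mean that
either `E` has CM, or there is a cuspidal, regular algebraic automorphic representation `π` of
`GL₂(𝔸_F)` which is regular algebraic of weight `0`, with `r_{π,ι} ≅ r_{E,p}^∨` for a prime `p` and
an isomorphism `ι : ℚ̄_p → ℂ`"* (p. 2: *"either `E` has complex multiplication or if there exists a
cuspidal automorphic representation `π` of `GL₂(𝔸_F)` of parallel weight `2` whose associated
`L`-function is the same as the `L`-function of `E`"*), together with Lemma 6.1.3 (p. 88,
[AKT23, Lemma 9.1]) for a modular `E` WITHOUT CM: *"(1) `π` has trivial central character and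
weight `0`, and is uniquely determined by `E`. (2) For every prime `p` and isomorphism
`ι : ℚ̄_p → ℂ`, there is an isomorphism `r_{π,ι} ≅ r_{E,p}^∨`. (3) For every isomorphism `ι` and
finite place `v ∤ p` of `F`, there is an isomorphism `WD(r_{E,p}^∨|_{G_{F_v}})^{F-ss} ≅
rec^T_{F_v}(π_v)`."*
Rendering.  `F` imaginary quadratic: `NumberField F`, `IsTotallyComplex F`, `finrank ℚ F = 2`.
`E`: a Weierstrass equation over `F` with `[E.IsElliptic]` and WITHOUT (geometric) complex
multiplication, `¬ E.HasCM` (`WeierstrassCurve.HasCM`: `End_{F̄}(E) ≠ ℤ`), so that the CM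
alternative of "modular" is excluded by hypothesis and Lemma 6.1.3 applies.  HYPOTHESIS: the
printed disjunction (1) ∨ (2), each alternative in the tree's rendering
`ModPImageAbsIrreducibleOverCyclotomic E p` (`TotallyRealModularityLargeImage`, there for
Freitas–Le Hung–Siksek Thm. 2 (ii)): for EVERY framing `ρ̄ : Γ_F →ₜ* GL₂(ZMod p)` of the Galois
module `E(F̄)[p]` (`WeierstrassCurve.IsTorsionGaloisRep E p ρ̄`) and every model `L ⊇ F` of
`F(ζ_p)` (`IsCyclotomicExtension {p} F L`) the restriction `ρ̄|_{Γ_L}` is absolutely irreducible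
(framings are conjugate and models isomorphic, so the quantifiers only avoid choices); at `p = 3`
with Mathlib's instance `Fact (Nat.Prime 3)`, at `p = 5` with the instance `⟨Nat.prime_five⟩`.
CONCLUSION: word for word that of the companion `CaraianiNewton2023_cor611_modular` (whose
hypothesis `SL₂(𝔽₃) ⊆ im ρ̄_{E,3}` implies (1),
`modPImageAbsIrreducibleOverCyclotomic_three_of_specialLinearGroup_le_range`, and excludes CM), on
the Borel–Jacquet data of `AutomorphicRepsGL`, the shape of the accepted `IsAutomorphicOfWeightZero`
(`ReciprocityGLnPotentialModularity`): there are `hF` (the compactness Prop needed to type `π`; it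
holds, `isCompact_glFiniteIntegralLevel_holds`) and a CUSPIDAL automorphic representation datum `π`
of `GL₂(𝔸_F)` of weight zero (`HasWeightZero`: `π_∞` cohomological for the trivial coefficients =
parallel weight `2` = regular algebraic of weight `0`; Lemma 6.1.3 (1)) such that at every finite
place `w` at which `E` has good reduction (`WeierstrassCurve.HasGoodReductionAt`: the chosen local
minimal model reduces to an elliptic curve `Ẽ_w / k_w`) `π_w` is unramified with Hecke polynomial
`X² − a_w(E) X + q_w` (`AutomorphicRepData.HasHeckePolynomialAt`, `frobPoly`,
`a_w(E) = q_w + 1 − #Ẽ_w(k_w) = E.frobeniusTraceAt w`): by Lemma 6.1.3 (2)–(3) with any `p ∤ w`,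
`r_{E,p}^∨|_{G_{F_w}}` is unramified with geometric-Frobenius polynomial `X² − a_w X + q_w`, so
`π_w` is unramified and its Hecke polynomial `P_w(X) = X² − T_{w,1} X + q_w T_{w,2}` — eq. (2.1.5),
p. 18: *"the characteristic polynomial of a Frobenius element on `rec^T_{F_v}(π_v)`"* — is
`X² − a_w X + q_w`; in the unitary normalisation of `AutomorphicRepData.HasSatakeParamAt`
(`T_{w,1} ↦ q_w^{1/2} e₁(α)`, `T_{w,2} ↦ e₂(α)`) this is literally
`HasHeckePolynomialAt w (X² − a_w X + q_w)`, i.e. `(X − q_w^{1/2} α₁)(X − q_w^{1/2} α₂) =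
X² − a_w X + q_w`, equivalently (p. 2) `L_w(π, s − 1/2) = L_w(E, s)` at the good places.  Nothing
is asserted at the places of bad reduction, at infinity beyond the weight, or for CM curves.  The
3-adic half of this proposition is LITERALLY hypothesis (A) of
`CaraianiNewton2023_cor611_modular_of_cor611_nonCM`; the statement is implied by, and no stronger
than, what the source prints and proves.  Unproved in the tree (the proof is the whole of the
source: §§2–5, Thm. 5.2, Thm. 6.1 with [AKT23], Lemma 6.2.2 — see "Status" in the module
docstring of `CaraianiNewtonResidualImageModularity`); users take
`(h : CaraianiNewton2023_cor611_nonCM_printed)`.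
-- TODO(general form): the CM alternative of "modular" (for CM curves the source asserts nothing
-- beyond "`E` has CM"); Thm. 6.1 over imaginary CM fields `F ∌ ζ₅` with the decomposed-generic
-- conditions; Thm. 7.1 / Thm. 1.1 for imaginary quadratic `F` (all curves, `X₀(15)(F)` finite —
-- the accepted `CaraianiNewton2023_modularity`).
[cite: CaraianiNewton2023, Cor. 6.1.1 p. 87 (hypotheses (1) and (2)), Lemma 6.1.3 p. 88, definition of modular in §6 p. 87 and on p. 2, eq. (2.1.5) p. 18]
[file NumberTheory/Automorphic/CaraianiNewtonResidualImageModularity] -/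
def CaraianiNewton2023_cor611_nonCM_printed : Prop :=
  ∀ (F : Type) [Field F] [NumberField F], NumberField.IsTotallyComplex F → Module.finrank ℚ F = 2 →
    ∀ (E : WeierstrassCurve F) [E.IsElliptic], ¬ E.HasCM →
      (Literature.NumberTheory.Automorphic.ModPImageAbsIrreducibleOverCyclotomic E 3 ∨
        @Literature.NumberTheory.Automorphic.ModPImageAbsIrreducibleOverCyclotomic F _ E 5
          ⟨Nat.prime_five⟩) →
      ∃ (hF : Literature.NumberTheory.Automorphic.isCompact_glFiniteIntegralLevel 2 F)
        (π : Literature.NumberTheory.Automorphic.CuspidalAutomorphicRepData 2 F hF),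
        π.1.HasWeightZero ∧
          ∀ w : IsDedekindDomain.HeightOneSpectrum (NumberField.RingOfIntegers F),
            E.HasGoodReductionAt w →
              π.1.HasHeckePolynomialAt w
                ((Literature.NumberTheory.Automorphic.frobPoly (E.frobeniusTraceAt w)
                    w.residueCard).map (Int.castRingHom ℂ))

/-! ### Sanity: the old hypothesis implies the new one; the new fact gives back the old one -/

open _root_.NumberField Field
open scoped _root_.NumberField

/-- **The narrow hypothesis implies the printed one.** If some framing `ρ̄₃` of `E[3]` has image
containing `SL₂(𝔽₃)` (the hypothesis of `CaraianiNewton2023_cor611_modular`), then alternative (1)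
of Cor. 6.1.1 holds in the tree's rendering, hence the disjunction (1) ∨ (2) assumed by
`CaraianiNewton2023_cor611_nonCM_printed`
(`modPImageAbsIrreducibleOverCyclotomic_three_of_specialLinearGroup_le_range`).
[cite: CaraianiNewton2023, Cor. 6.1.1 (1) p. 87] -/
theorem CaraianiNewton2023_cor611_nonCM_printed.hyp_of_specialLinearGroup_le_range
    {K : Type} [Field K] [CharZero K] (E : WeierstrassCurve K) [E.IsElliptic]
    (h : ∃ ρ₃ : Literature.NumberTheory.GaloisRepresentations.FramedGaloisRep K (ZMod 3) 2,
      E.IsTorsionGaloisRep 3 ρ₃ ∧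
        ∀ g : Matrix.SpecialLinearGroup (Fin 2) (ZMod 3), ∃ σ,
          ρ₃ σ = Matrix.SpecialLinearGroup.toGL g) :
    ModPImageAbsIrreducibleOverCyclotomic E 3 ∨
      @ModPImageAbsIrreducibleOverCyclotomic K _ E 5 ⟨Nat.prime_five⟩ :=
  Or.inl (modPImageAbsIrreducibleOverCyclotomic_three_of_specialLinearGroup_le_range E h)

/-- **The printed fact gives back the narrow one**, granted the classical small mod-`3` image of
CM curves (hypothesis (B) of `CaraianiNewton2023_cor611_modular_of_cor611_nonCM`, a HYPOTHESIS with
no carrier in the tree): `CaraianiNewton2023_cor611_nonCM_printed` restricted to alternative (1)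
is literally hypothesis (A) of that theorem.
[cite: CaraianiNewton2023, Cor. 6.1.1 (1) p. 87, Lemma 6.1.3 p. 88] -/
theorem CaraianiNewton2023_cor611_nonCM_printed.cor611_modular
    (h : CaraianiNewton2023_cor611_nonCM_printed)
    (hB : ∀ (F : Type) [Field F] [NumberField F] (E : WeierstrassCurve F) [E.IsElliptic],
      E.HasCM → ¬ ∃ ρ₃ : Literature.NumberTheory.GaloisRepresentations.FramedGaloisRep F (ZMod 3) 2,
        E.IsTorsionGaloisRep 3 ρ₃ ∧
          ∀ g : Matrix.SpecialLinearGroup (Fin 2) (ZMod 3), ∃ σ,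
            ρ₃ σ = Matrix.SpecialLinearGroup.toGL g) :
    CaraianiNewton2023_cor611_modular :=
  CaraianiNewton2023_cor611_modular_of_cor611_nonCM
    (fun F _ _ hF hF2 E _ hCM h3 ↦ h F hF hF2 E hCM (Or.inl h3)) hB

/-- **Reading the conclusion of the printed fact as the trace identity.** Granted
`CaraianiNewton2023_cor611_nonCM_printed`, for `F` imaginary quadratic and `E / F` elliptic without
CM satisfying (1) or (2) there is a weight-zero cuspidal `π` of `GL₂(𝔸_F)` which, at every finite
place `w` of good reduction, is unramified with a Satake parameter `α = {α₁, α₂}` satisfying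
`q_w^{1/2}(α₁ + α₂) = a_w(E)` and `(q_w^{1/2} α₁)(q_w^{1/2} α₂) = q_w`
(`exists_hasSatakeParamAt_of_hasHeckePolynomialAt_frobPoly`): the Euler factor identity
`L_w(π, s - 1/2) = L_w(E, s)` of the source's definition of "modular" (p. 2).
[cite: CaraianiNewton2023, Cor. 6.1.1 p. 87 and p. 2 (definition of modular)] -/
theorem CaraianiNewton2023_cor611_nonCM_printed.exists_hasSatakeParamAt
    (h : CaraianiNewton2023_cor611_nonCM_printed) (F : Type) [Field F] [NumberField F]
    (hF : NumberField.IsTotallyComplex F) (hF2 : Module.finrank ℚ F = 2) (E : WeierstrassCurve F)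
    [E.IsElliptic] (hCM : ¬ E.HasCM)
    (hE : ModPImageAbsIrreducibleOverCyclotomic E 3 ∨
      @ModPImageAbsIrreducibleOverCyclotomic F _ E 5 ⟨Nat.prime_five⟩) :
    ∃ (hc : isCompact_glFiniteIntegralLevel 2 F) (π : CuspidalAutomorphicRepData 2 F hc),
      π.1.HasWeightZero ∧
        ∀ w : HeightOneSpectrum (𝓞 F), E.HasGoodReductionAt w →
          ∃ α : Multiset ℂ, π.1.HasSatakeParamAt w α ∧
            ((Real.sqrt w.residueCard : ℝ) : ℂ) * α.sum = (E.frobeniusTraceAt w : ℂ) ∧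
            ((Real.sqrt w.residueCard : ℝ) : ℂ) ^ 2 * α.prod = (w.residueCard : ℂ) := by
  obtain ⟨hc, π, h0, hH⟩ := h F hF hF2 E hCM hE
  exact ⟨hc, π, h0, fun w hw ↦ exists_hasSatakeParamAt_of_hasHeckePolynomialAt_frobPoly (hH w hw)⟩

/-! ### The printed proof of Cor. 6.1.1: "Combine Theorem 6.1 and Lemma 6.2.2" (a reduction)

The source proves Cor. 6.1.1 in one line (p. 87): *"Proof. Combine Theorem 6.1 and Lemma 6.2.2."*
Both ingredients lack carriers in Mathlib and `Literature` (module docstring, "Status"), and D-0026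
forbids minting them as named facts from a discharge seat, so below they are HYPOTHESES of a
reduction theorem, each rendered in the tree's vocabulary — Theorem 6.1 with the decomposed-generic
condition of [ACC⁺23, Def. 4.3.1] (`IsDecomposedGeneric`, file
`GaloisRepresentations/DecomposedGeneric`) and Mathlib's `NumberField.IsCMField`; Lemma 6.2.2
verbatim — and the glue the one-line proof leaves implicit is proved: an imaginary quadratic
field is an imaginary CM field (`IsCMField.ofCMExtension ℚ F`) not containing `ζ₅`
(`eq_one_of_pow_eq_one_of_finrank_lt`: `[ℚ(ζ₅) : ℚ] = 4 > 2`), and Lemma 6.2.2 at `p = 3`,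
resp. `p = 5`, turns hypothesis (1), resp. (2), of the corollary into hypothesis (1), resp. (2),
of the theorem. -/

/-- **A number field of degree `< p - 1` contains no non-trivial `p`-th root of unity** (`p`
prime): a `p`-th root of unity `x ≠ 1` is a primitive `p`-th root of unity, whose minimal
polynomial over `ℚ` is the cyclotomic polynomial `Φ_p` of degree `p - 1`
(`Polynomial.cyclotomic_eq_minpoly_rat`), while `deg minpoly_ℚ(x) ≤ [F : ℚ]`
(`minpoly.natDegree_le`).  Used with `p = 5`, `[F : ℚ] = 2`: an imaginary quadratic field does
not contain `ζ₅`, the standing hypothesis "`ζ₅ ∉ F`" of Caraiani–Newton, Thm. 6.1. [folklore] -/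
theorem eq_one_of_pow_eq_one_of_finrank_lt {F : Type*} [Field F] [NumberField F] {p : ℕ}
    (hp : p.Prime) (hF : Module.finrank ℚ F < p - 1) {x : F} (hx : x ^ p = 1) : x = 1 := by
  by_contra hx1
  have horder : orderOf x = p := by
    rcases (Nat.dvd_prime hp).1 (orderOf_dvd_of_pow_eq_one hx) with h1 | h1
    · exact absurd (orderOf_eq_one_iff.1 h1) hx1
    · exact h1
  have hprim : IsPrimitiveRoot x p := horder ▸ IsPrimitiveRoot.orderOf x
  have hdeg := minpoly.natDegree_le (A := ℚ) x
  rw [← Polynomial.cyclotomic_eq_minpoly_rat hprim hp.pos, Polynomial.natDegree_cyclotomic,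
    Nat.totient_prime hp] at hdeg
  omega

/-- **An imaginary quadratic field does not contain `ζ₅`** (`[ℚ(ζ₅) : ℚ] = 4 > 2`): the
hypothesis "`ζ₅ ∉ F`" of Caraiani–Newton, Thm. 6.1, for the fields of Cor. 6.1.1. [folklore] -/
theorem eq_one_of_pow_five_eq_one_of_finrank_eq_two {F : Type*} [Field F] [NumberField F]
    (hF2 : Module.finrank ℚ F = 2) {x : F} (hx : x ^ 5 = 1) : x = 1 :=
  eq_one_of_pow_eq_one_of_finrank_lt Nat.prime_five (by omega) hx

/-- **An imaginary quadratic field is an imaginary CM field** in Mathlib's sense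
(`NumberField.IsCMField`: a totally complex quadratic extension of its maximal real subfield, here
`ℚ`; Mathlib `IsCMField.ofCMExtension`): the fields of Cor. 6.1.1 are among those of
Caraiani–Newton, Thm. 6.1. [folklore] -/
theorem isCMField_of_isTotallyComplex_of_finrank_eq_two (F : Type*) [Field F] [NumberField F]
    (hF : NumberField.IsTotallyComplex F) (hF2 : Module.finrank ℚ F = 2) :
    NumberField.IsCMField F := by
  haveI := hF
  haveI : Algebra.IsQuadraticExtension ℚ F := { finrank_eq_two' := hF2 }
  exact NumberField.IsCMField.ofCMExtension ℚ F

/-- **Cor. 6.1.1 (non-CM, as printed) from Theorem 6.1 and Lemma 6.2.2 — the printed proof**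
(p. 87: *"Proof. Combine Theorem 6.1 and Lemma 6.2.2."*), with both ingredients as explicit
HYPOTHESES (no carriers in the tree; not named facts, D-0026):

(A) [**Theorem 6.1**, p. 87, for curves without CM, "modular" read through Lemma 6.1.3 (p. 88)
exactly as in the conclusion of the fact]: *"Let `F` be an imaginary CM number field with
`ζ₅ ∉ F`. Let `E/F` be an elliptic curve satisfying one of the following two conditions:
(1) `r̄_{E,3}` is decomposed generic and `r̄_{E,3}|_{G_{F(ζ₃)}}` is absolutely irreducible.
(2) `r̄_{E,5}` is decomposed generic and `r̄_{E,5}|_{G_{F(ζ₅)}}` is absolutely irreducible. Then `E`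
is modular."* Rendered: `F` a number field with `NumberField.IsCMField F` (totally complex,
quadratic over its maximal real subfield) in which every fifth root of unity is `1`; `E` elliptic
with `¬ E.HasCM`; `p = 3` or `p = 5`; every framing `ρ̄` of `E[p]` (`IsTorsionGaloisRep`; framings
are conjugate, `WeierstrassCurve.IsTorsionGaloisRep.exists_conj`, and decomposed genericity is a
property of the unramified Frobenius eigenvalues, so "every" = "some") is decomposed generic in
the sense of [ACC⁺23, Def. 4.3.1] — `IsDecomposedGeneric`: a prime `l ≠ p` split in `F` with `ρ̄`
unramified above `l` and Frobenius eigenvalues `α_i ≠ α_j`, `α_i ≠ l α_j`; the source's own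
Definition 2.1.27 (p. 25, footnote 13: "slightly weaker than the condition called decomposed
generic in [CS17]") omits `α_i ≠ α_j`, so this hypothesis asks slightly MORE of `E` than the
printed one and (A) so rendered is implied by the printed Theorem 6.1 (and Lemma 6.2.2 delivers the
stronger condition anyway: for `l ≡ 1 mod p` the two coincide) — and
`ModPImageAbsIrreducibleOverCyclotomic E p`; conclusion word for word that of the fact.
(L) [**Lemma 6.2.2**, p. 90]: *"Let `F/ℚ` be a quadratic field, let `p` be an odd prime, and let
`ρ̄ : G_F → GL₂(𝔽_p)` be a homomorphism. Suppose that `ρ̄|_{G_{F(ζ_p)}}` is absolutely irreducible.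
Then `ρ̄` is decomposed generic."* Rendered for continuous `ρ̄ : Γ_F →ₜ* GL₂(𝔽_p)`
(`ModPGaloisRep`), with "`ρ̄|_{G_{F(ζ_p)}}` absolutely irreducible" as in
`ModPImageAbsIrreducibleOverCyclotomic` (every model `L` of `F(ζ_p)`, `FramedGaloisRep.restrictField`).
Then `CaraianiNewton2023_cor611_nonCM_printed` holds: `F` imaginary quadratic is imaginary CM
(`isCMField_of_isTotallyComplex_of_finrank_eq_two`) with `ζ₅ ∉ F`
(`eq_one_of_pow_five_eq_one_of_finrank_eq_two`), and (L) at `p = 3` (resp. `5`) upgrades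
hypothesis (1) (resp. (2)) of the corollary to hypothesis (1) (resp. (2)) of (A).  This theorem
records the architecture of the printed proof in the tree's vocabulary; it is a reduction, not a
discharge — (A) is the automorphy lifting theorem Thm. 5.2 with [AKT23] and solvable descent
(proof of Thm. 6.1, p. 90) and has no carrier; (L) is proved in the source (pp. 90–91) from
Goursat, Dickson and Chebotarev — its group-theoretic heart is
`CaraianiNewton.exists_disc_ne_zero_and_disc_apply_ne_zero`
(`GaloisRepresentations/CartanNormalizerCriterionGaloisImage`) and Chebotarev is the tree's proved
`Literature.NumberTheory.Automorphic.chebotarev_artinRep_holds`, and its Galois-theoretic assembly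
is the tree's theorem `isDecomposedGeneric_of_isAbsolutelyIrreducible_restrictField_cyclotomic`
(file `GaloisRepresentations/DecomposedGenericOfQuadratic`), whose statement is (L) verbatim; (L)
is kept as a hypothesis HERE only to spare this file (and its Summits importers) that import, and
is discharged in the sibling `Automorphic/CaraianiNewtonResidualImageModularityProofs`
(`CaraianiNewton2023_cor611_nonCM_printed_of_thm61`: a one-line application of this theorem to
that one).
[cite: CaraianiNewton2023, Cor. 6.1.1 p. 87 (proof: "Combine Theorem 6.1 and Lemma 6.2.2"), Thm. 6.1 p. 87, Lemma 6.2.2 p. 90, Lemma 6.1.3 p. 88] -/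
theorem CaraianiNewton2023_cor611_nonCM_printed_of_thm61_of_lemma622
    (hA : ∀ (F : Type) [Field F] [NumberField F], NumberField.IsCMField F →
      (∀ x : F, x ^ 5 = 1 → x = 1) → ∀ (E : WeierstrassCurve F) [E.IsElliptic], ¬ E.HasCM →
        ∀ (p : ℕ) [Fact p.Prime], (p = 3 ∨ p = 5) →
          (∀ ρ : ModPGaloisRep F (ZMod p) 2, E.IsTorsionGaloisRep p ρ →
            IsDecomposedGeneric (ρ : absoluteGaloisGroup F →* GL (Fin 2) (ZMod p))) →
          ModPImageAbsIrreducibleOverCyclotomic E p →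
            ∃ (hF : isCompact_glFiniteIntegralLevel 2 F) (π : CuspidalAutomorphicRepData 2 F hF),
              π.1.HasWeightZero ∧
                ∀ w : HeightOneSpectrum (𝓞 F), E.HasGoodReductionAt w →
                  π.1.HasHeckePolynomialAt w
                    ((frobPoly (E.frobeniusTraceAt w) w.residueCard).map (Int.castRingHom ℂ)))
    (hL : ∀ (F : Type) [Field F] [NumberField F], Module.finrank ℚ F = 2 →
      ∀ (p : ℕ) [Fact p.Prime], p ≠ 2 → ∀ ρ : ModPGaloisRep F (ZMod p) 2,
        (∀ (L : Type) [Field L] [Algebra F L] [IsCyclotomicExtension {p} F L],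
          FramedRep.IsAbsolutelyIrreducible (FramedGaloisRep.restrictField L ρ)) →
        IsDecomposedGeneric (ρ : absoluteGaloisGroup F →* GL (Fin 2) (ZMod p))) :
    CaraianiNewton2023_cor611_nonCM_printed := by
  intro F _ _ hF hF2 E _ hCM h
  have hCMF := isCMField_of_isTotallyComplex_of_finrank_eq_two F hF hF2
  have h5 : ∀ x : F, x ^ 5 = 1 → x = 1 := fun x hx ↦
    eq_one_of_pow_five_eq_one_of_finrank_eq_two hF2 hx
  rcases h with h3 | h5'
  · exact hA F hCMF h5 E hCM 3 (Or.inl rfl)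
      (fun ρ hρ ↦ hL F hF2 3 (by decide) ρ (fun L _ _ _ ↦ h3 ρ hρ L)) h3
  · haveI : Fact (Nat.Prime 5) := ⟨Nat.prime_five⟩
    exact hA F hCMF h5 E hCM 5 (Or.inr rfl)
      (fun ρ hρ ↦ hL F hF2 5 (by decide) ρ (fun L _ _ _ ↦ h5' ρ hρ L)) h5'

end Literature.NumberTheory.Automorphic
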